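import Literature.NumberTheory.EllipticCurves.SelmerPInftyRestriction
import Literature.NumberTheory.EllipticCurves.DiscreteH1Equiv
import Literature.NumberTheory.EllipticCurves.SubgroupSelmer
import HarnessLib

/-!
# Base change of subgroup cohomology: `H¹(res⁻¹ U, E_L[p^∞]) ≃ H¹(U, E[p^∞])` for a subgroup
# `U ≤ Gal(K̄/L)` of `Γ_K`, compatible with restriction and conjugation
(cell `bsd-potss`, seat `bsd-potss-ctrl` g2; T-e2-R1⁺ piece (i), brick (i-c3) — the group/coefficient
half of the comparison «Kobayashi's Selmer groups of `E_F` over the `ℤ_p`-tower of `F` (Γ_F-internal)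
= cc-typer-6's tower objects of `E` over `F·ℚ_∞` (Γ_ℚ-internal)»; the tree's `modelIso`
(`SelmerPInftyRestriction`, `U = galRange L`) and n1011-p01's `kerH1Iso` (`ZpTowerKernelH1`,
`U = ker κ`) are the two special cases; TARGET.md v6 §0.12 (e) piece (i))

HONEST FRAMING (cell `bsd-potss`, run/shared/lean/pub/bsd-potss/; FULL-BSD rank ≤ 1 programme,
tranche 1b): INFRASTRUCTURE — DEFINITIONS (two continuous homomorphisms and one additive isomorphism,
transparent) + THEOREMS; no named Literature fact, no `Prop` definition, no `sorry`, axioms standard;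
nothing is booked; no label / mark / count moves; nothing about (C1_η) or `BSD(W, p)` is claimed.

## What (any fields `K ⊆ L` with `L/K` algebraic and `L` perfect; `W/K`; `U ≤ galRange L ≤ Γ_K`;
## `U^L := U.comap (resGal L) ≤ Γ_L`)
* `comapToSubgroup U : U^L →ₜ* U` (`σ ↦ σ|_{K̄}`) and `subgroupToComap hU : U →ₜ* U^L`
  (`τ ↦ (resGal L)⁻¹ τ` through `rangeToResGal`), mutually inverse; compatible pairs with
  `primaryBaseChangeEquiv` (`E[p^∞](K̄) ≃ E_L[p^∞](L̄)`).
* **`subgroupH1Iso hU : (W.baseChange L).subgroupH1 p U^L ≃+ W.subgroupH1 p U`** — verbatim the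
  construction of `kerH1Iso` / `modelIso`.
* `subgroupH1Iso_resOfLe` — commutes with restriction (`U₂ ≤ U₁`);
  `subgroupH1Iso_conjH1` — intertwines `conj_{g'}` on the `L`-side with `conj_{resGal g'}` on the
  `K`-side (`U` normal in `Γ_K`).

References: [SerreGaloisCohomology1997] I.§2.4–2.5, II.§1.1; [GreenbergLNM1716] §1 (restriction maps).
-/

noncomputable section

open scoped Classical

open Literature.NumberTheory.EllipticCurves

universe u

namespace Summit.BirchSwinnertonDyer.Rank1Residual.Additive.BaseChange

variable {K : Type u} [Field K] (L : Type u) [Field L] [Algebra K L] [Algebra.IsAlgebraic K L]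
  [PerfectField L] (W : WeierstrassCurve K) (p : ℕ)
  (U : Subgroup (Field.absoluteGaloisGroup K))

/-- `U^L := U.comap (resGal L)`, the subgroup `res⁻¹ U ≤ Γ_L`. [cite: SerreGaloisCohomology1997, II.§1.1] -/
abbrev comapResGal : Subgroup (Field.absoluteGaloisGroup L) :=
  U.comap ((resGal (K := K) L : Field.absoluteGaloisGroup L →ₜ* Field.absoluteGaloisGroup K) :
    Field.absoluteGaloisGroup L →* Field.absoluteGaloisGroup K)

omit [Algebra.IsAlgebraic K L] [PerfectField L] in
/-- Membership in `U^L`. [folklore] -/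
theorem mem_comapResGal_iff (σ : Field.absoluteGaloisGroup L) :
    σ ∈ comapResGal L U ↔ resGal (K := K) L σ ∈ U :=
  Iff.rfl

/-- **`U^L → U`, `σ ↦ σ|_{K̄}`**, a continuous monoid homomorphism. [cite: SerreGaloisCohomology1997, II.§1.1] -/
def comapToSubgroup : comapResGal L U →ₜ* U where
  toFun σ := ⟨resGal (K := K) L σ, σ.2⟩
  map_one' := Subtype.ext (map_one _)
  map_mul' _ _ := Subtype.ext (map_mul _ _ _)
  continuous_toFun :=
    ((resGal (K := K) L).continuous_toFun.comp continuous_subtype_val).subtype_mk _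

omit [Algebra.IsAlgebraic K L] [PerfectField L] in
/-- Values of `comapToSubgroup`. [folklore] -/
@[simp]
theorem coe_comapToSubgroup (σ : comapResGal L U) :
    ((comapToSubgroup L U σ : U) : Field.absoluteGaloisGroup K) = resGal (K := K) L σ :=
  rfl

variable {U} (hU : U ≤ galRange (K := K) L)

/-- `U → Γ_L`, `τ ↦ (resGal L|^{galRange})⁻¹ τ` (`rangeToResGal L` on `U ≤ galRange L`), a continuous
monoid homomorphism. [cite: SerreGaloisCohomology1997, II.§1.1] -/
def toGal : U →ₜ* Field.absoluteGaloisGroup L where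
  toFun τ := rangeToResGal (K := K) L ⟨τ, hU τ.2⟩
  map_one' := by
    rw [show (⟨((1 : U) : Field.absoluteGaloisGroup K), hU (1 : U).2⟩ : galRange (K := K) L) = 1
      from rfl, map_one]
  map_mul' σ τ := by
    rw [show (⟨((σ * τ : U) : Field.absoluteGaloisGroup K), hU (σ * τ : U).2⟩ :
        galRange (K := K) L) = ⟨σ, hU σ.2⟩ * ⟨τ, hU τ.2⟩ from rfl, map_mul]
  continuous_toFun :=
    (rangeToResGal (K := K) L).continuous_toFun.comp (continuous_subtype_val.subtype_mk _)

/-- Unfolding `toGal`. [folklore] -/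
theorem toGal_apply (τ : U) : toGal L hU τ = rangeToResGal (K := K) L ⟨τ, hU τ.2⟩ :=
  rfl

/-- `resGal (toGal τ) = τ`. [folklore] -/
@[simp]
theorem resGal_toGal (τ : U) : resGal (K := K) L (toGal L hU τ) = τ := by
  rw [toGal_apply, resGal_rangeToResGal]

/-- `toGal` lands in `U^L`. [folklore] -/
theorem toGal_mem (τ : U) : toGal L hU τ ∈ comapResGal L U := by
  rw [mem_comapResGal_iff, resGal_toGal]
  exact τ.2

/-- **`U → U^L`, `τ ↦ (resGal L)⁻¹ τ`** (through `rangeToResGal L` on `U ≤ galRange L`), a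
continuous monoid homomorphism. [cite: SerreGaloisCohomology1997, II.§1.1] -/
def subgroupToComap : U →ₜ* comapResGal L U where
  toFun τ := ⟨toGal L hU τ, toGal_mem L hU τ⟩
  map_one' := Subtype.ext (map_one (toGal L hU))
  map_mul' σ τ := Subtype.ext (map_mul (toGal L hU) σ τ)
  continuous_toFun := (toGal L hU).continuous_toFun.subtype_mk _

/-- Values of `subgroupToComap` in `Γ_K`: `resGal (subgroupToComap τ) = τ`. [folklore] -/
@[simp]
theorem resGal_subgroupToComap (τ : U) :
    resGal (K := K) L (subgroupToComap L hU τ : comapResGal L U) = τ :=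
  resGal_toGal L hU τ

/-- `comapToSubgroup ∘ subgroupToComap = id`. [folklore] -/
@[simp]
theorem comapToSubgroup_subgroupToComap (τ : U) :
    comapToSubgroup L U (subgroupToComap L hU τ) = τ :=
  Subtype.ext (resGal_subgroupToComap L hU τ)

/-- `subgroupToComap ∘ comapToSubgroup = id` (`resGal L` is injective). [folklore] -/
@[simp]
theorem subgroupToComap_comapToSubgroup (σ : comapResGal L U) :
    subgroupToComap L hU (comapToSubgroup L U σ) = σ := by
  apply Subtype.ext
  apply resGal_injective (K := K) L
  rw [resGal_subgroupToComap]
  rfl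

omit [PerfectField L] in
/-- Compatibility of the pair `(comapToSubgroup, primaryBaseChangeEquiv)`. [folklore] -/
theorem primaryBaseChangeEquiv_comapToSubgroup_smul (σ : comapResGal L U)
    (P : W.geomPrimaryTorsion p) :
    primaryBaseChangeEquiv L W p (comapToSubgroup L U σ • P) = σ • primaryBaseChangeEquiv L W p P := by
  rw [Subgroup.smul_def, Subgroup.smul_def, coe_comapToSubgroup,
    ← primaryBaseChangeEquiv_smul L W p (σ : Field.absoluteGaloisGroup L) P, Subgroup.smul_def,
    coe_resGalToRange]

/-- Compatibility of the pair `(subgroupToComap, primaryBaseChangeEquiv⁻¹)`. [folklore] -/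
theorem primaryBaseChangeEquiv_symm_subgroupToComap_smul (τ : U)
    (Q : (W.baseChange L).geomPrimaryTorsion p) :
    (primaryBaseChangeEquiv L W p).symm (subgroupToComap L hU τ • Q) =
      τ • (primaryBaseChangeEquiv L W p).symm Q := by
  rw [Subgroup.smul_def, Subgroup.smul_def]
  have h := primaryBaseChangeEquiv_symm_smul L W p ⟨τ, hU τ.2⟩ Q
  rw [Subgroup.smul_def] at h
  exact h

/-- **`H¹(U^L, E_L[p^∞]) ≃ H¹(U, E[p^∞])`** for `U ≤ galRange L`: the maps of the mutually inverse
compatible pairs `(subgroupToComap, primaryBaseChangeEquiv⁻¹)` and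
`(comapToSubgroup, primaryBaseChangeEquiv)`. [cite: SerreGaloisCohomology1997, I.§2.4] -/
def subgroupH1Iso : (W.baseChange L).subgroupH1 p (comapResGal L U) ≃+ W.subgroupH1 p U where
  toFun := resH1Hom (subgroupToComap L hU) (primaryBaseChangeEquiv L W p).symm.toAddMonoidHom
    (primaryBaseChangeEquiv_symm_subgroupToComap_smul L W p hU)
  invFun := resH1Hom (comapToSubgroup L U) (primaryBaseChangeEquiv L W p).toAddMonoidHom
    (primaryBaseChangeEquiv_comapToSubgroup_smul L W p)
  left_inv x := by
    rw [resH1Hom_resH1Hom]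
    have e : resH1Hom ((subgroupToComap L hU).comp (comapToSubgroup L U))
        ((primaryBaseChangeEquiv L W p).toAddMonoidHom.comp
          (primaryBaseChangeEquiv L W p).symm.toAddMonoidHom)
        (fun x m ↦ by
          simp only [AddMonoidHom.coe_comp, Function.comp_apply, AddEquiv.coe_toAddMonoidHom,
            ContinuousMonoidHom.comp_toFun, primaryBaseChangeEquiv_symm_subgroupToComap_smul,
            primaryBaseChangeEquiv_comapToSubgroup_smul]) =
          resH1Hom (ContinuousMonoidHom.id _) (AddMonoidHom.id _) (fun _ _ ↦ rfl) :=
      resH1Hom_congr (ContinuousMonoidHom.ext fun σ ↦ subgroupToComap_comapToSubgroup L hU σ)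
        (AddMonoidHom.ext fun Q ↦ (primaryBaseChangeEquiv L W p).apply_symm_apply Q) _ _
    rw [e, resH1Hom_id]
    rfl
  right_inv x := by
    rw [resH1Hom_resH1Hom]
    have e : resH1Hom ((comapToSubgroup L U).comp (subgroupToComap L hU))
        ((primaryBaseChangeEquiv L W p).symm.toAddMonoidHom.comp
          (primaryBaseChangeEquiv L W p).toAddMonoidHom)
        (fun x m ↦ by
          simp only [AddMonoidHom.coe_comp, Function.comp_apply, AddEquiv.coe_toAddMonoidHom,
            ContinuousMonoidHom.comp_toFun, primaryBaseChangeEquiv_symm_subgroupToComap_smul,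
            primaryBaseChangeEquiv_comapToSubgroup_smul]) =
          resH1Hom (ContinuousMonoidHom.id _) (AddMonoidHom.id _) (fun _ _ ↦ rfl) :=
      resH1Hom_congr (ContinuousMonoidHom.ext fun τ ↦ comapToSubgroup_subgroupToComap L hU τ)
        (AddMonoidHom.ext fun P ↦ (primaryBaseChangeEquiv L W p).symm_apply_apply P) _ _
    rw [e, resH1Hom_id]
    rfl
  map_add' := map_add _

/-- `subgroupH1Iso` as a function. [folklore] -/
theorem subgroupH1Iso_apply (x : (W.baseChange L).subgroupH1 p (comapResGal L U)) :
    subgroupH1Iso L W p hU x = resH1Hom (subgroupToComap L hU)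
      (primaryBaseChangeEquiv L W p).symm.toAddMonoidHom
      (primaryBaseChangeEquiv_symm_subgroupToComap_smul L W p hU) x :=
  rfl

/-- `subgroupH1Iso⁻¹` as a function. [folklore] -/
theorem subgroupH1Iso_symm_apply (y : W.subgroupH1 p U) :
    (subgroupH1Iso L W p hU).symm y = resH1Hom (comapToSubgroup L U)
      (primaryBaseChangeEquiv L W p).toAddMonoidHom
      (primaryBaseChangeEquiv_comapToSubgroup_smul L W p) y :=
  rfl

omit [Algebra.IsAlgebraic K L] [PerfectField L] in
/-- `U₂ ≤ U₁ ⟹ U₂^L ≤ U₁^L`. [folklore] -/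
theorem comapResGal_mono {U₁ U₂ : Subgroup (Field.absoluteGaloisGroup K)} (h : U₂ ≤ U₁) :
    comapResGal L U₂ ≤ comapResGal L U₁ :=
  Subgroup.comap_mono h

/-- **`subgroupH1Iso` commutes with restriction**: for `U₂ ≤ U₁ ≤ galRange L`,
`iso_{U₂} ∘ res = res ∘ iso_{U₁}`. [cite: SerreGaloisCohomology1997, I.§2.5] -/
theorem subgroupH1Iso_resOfLe {U₁ U₂ : Subgroup (Field.absoluteGaloisGroup K)}
    (hU₁ : U₁ ≤ galRange (K := K) L) (h : U₂ ≤ U₁)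
    (x : (W.baseChange L).subgroupH1 p (comapResGal L U₁)) :
    subgroupH1Iso L W p (h.trans hU₁) ((W.baseChange L).resOfLe p (comapResGal_mono L h) x) =
      W.resOfLe p h (subgroupH1Iso L W p hU₁ x) := by
  rw [subgroupH1Iso_apply, subgroupH1Iso_apply, WeierstrassCurve.resOfLe, WeierstrassCurve.resOfLe,
    Literature.NumberTheory.EllipticCurves.resOfLe, Literature.NumberTheory.EllipticCurves.resOfLe,
    resH1Hom_resH1Hom, resH1Hom_resH1Hom]
  exact DFunLike.congr_fun (resH1Hom_congr (ContinuousMonoidHom.ext fun τ ↦ Subtype.ext rfl)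
    (AddMonoidHom.ext fun _ ↦ rfl) _ _) x

/-- **`subgroupH1Iso` intertwines conjugation**: for `U` normal in `Γ_K` and `g' ∈ Γ_L`,
`iso (conj_{g'} x) = conj_{g'|_{K̄}} (iso x)`. [cite: SerreGaloisCohomology1997, I.§2.5] -/
theorem subgroupH1Iso_conjH1 [U.Normal] (g' : Field.absoluteGaloisGroup L)
    (x : (W.baseChange L).subgroupH1 p (comapResGal L U)) :
    subgroupH1Iso L W p hU ((W.baseChange L).conjH1 p (comapResGal L U) g' x) =
      W.conjH1 p U (resGal (K := K) L g') (subgroupH1Iso L W p hU x) := by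
  rw [subgroupH1Iso_apply, subgroupH1Iso_apply, WeierstrassCurve.conjH1, WeierstrassCurve.conjH1,
    Literature.NumberTheory.EllipticCurves.conjH1, Literature.NumberTheory.EllipticCurves.conjH1,
    resH1Hom_resH1Hom, resH1Hom_resH1Hom]
  refine DFunLike.congr_fun (resH1Hom_congr (ContinuousMonoidHom.ext fun τ ↦ ?_)
    (AddMonoidHom.ext fun Q ↦ ?_) _ _) x
  · -- `g'⁻¹ (res⁻¹ τ) g' = res⁻¹ ((res g')⁻¹ τ (res g'))`
    apply Subtype.ext
    apply resGal_injective (K := K) L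
    change resGal (K := K) L (g'⁻¹ * (subgroupToComap L hU τ : comapResGal L U) * g') =
      resGal (K := K) L (subgroupToComap L hU (subgroupConj U (resGal (K := K) L g') τ) :
        comapResGal L U)
    rw [map_mul, map_mul, map_inv, resGal_subgroupToComap, resGal_subgroupToComap,
      subgroupConj_apply_coe]
  · -- `E⁻¹ (g' • Q) = (res g') • E⁻¹ Q`
    change (primaryBaseChangeEquiv L W p).symm (g' • Q) =
      resGal (K := K) L g' • (primaryBaseChangeEquiv L W p).symm Q
    have h := primaryBaseChangeEquiv_symm_smul L W p (resGalToRange (K := K) L g') Q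
    rw [rangeToResGal_resGalToRange, Subgroup.smul_def, coe_resGalToRange] at h
    exact h

end Summit.BirchSwinnertonDyer.Rank1Residual.Additive.BaseChange

end
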